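import Literature.AlgebraicGeometry.Resolution.DerivativeIdealSheaf
import Literature.AlgebraicGeometry.Resolution.RegularLocalRingsQuotient
import HarnessLib

/-!
# Marked ideals of maximal order and tangent directions (BGMW 2011, §3.6)

Topic: `Literature/AlgebraicGeometry/Resolution`. Bierstone–Grigoriev–Milman–Włodarczyk,
*Effective Hironaka resolution and its complexity*, arXiv:1206.3090, §3.6 ("Hypersurfaces of
maximal contact"), at the sheaf level over the marked ideals `MarkedIdeal X` of `MarkedIdeals.lean`
and the derivative ideal sheaves `𝒟ⁱ` of `DerivativeIdealSheaf.lean` (scheme `X` with a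
`k`-structure `φ` and finitely presented differentials):

* `MarkedIdeal.IsOfMaxOrder φ M` — **Def. 3.6.1** ("a marked ideal `(𝓘, μ)` is of maximal order
  … if `max {ord_x(𝓘) | x ∈ X} ≤ μ` or equivalently `𝒟^μ(𝓘) = 𝒪_X`"), in the form
  `𝒟^μ(𝓘) = 𝒪_X` (the ring-level `IsOfMaxOrder` of `CoefficientIdeals.lean` sheafified);
  `IsOfMaxOrder.idealOrder_le` — it implies `ord_x 𝓘 ≤ μ` everywhere (the other half of the
  printed equivalence needs coordinates and `μ < p`; planned file `MarkedIdealsSupport.lean`);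
* `IsOfMaxOrder.deriv` — **Lemma 3.6.3** ("if `(𝓘, μ)` is of maximal order and `0 ≤ i ≤ μ` then
  `𝒟ⁱ(𝓘, μ)` is of maximal order") — PROVED;
* `IsOfMaxOrder.exists_tangentDirection` — **existence of tangent directions at the points of
  the support** (Def. 3.6.5: "a function `u ∈ T(𝓘)(U) := 𝒟^{μ-1}(𝓘(U))` of multiplicity one [is]
  a tangent direction"; Step 1b of the algorithm, arXiv p. 12: "for any `x ∈ supp 𝓙` find a tangent
  direction `u ∈ 𝒟^{μ(𝓙)-1}(𝓙)` on some neighborhood `U` of `x`"): for `(𝓘, μ)` of maximal order,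
  `μ ≥ 1`, and `x ∈ supp(𝓘, μ)` there is `u ∈ 𝒟^{μ-1}(𝓘)_x` with `u ∈ 𝔪_x ∖ 𝔪_x²` — PROVED in
  EVERY characteristic (`𝒟^{μ-1}(𝓘)_x ⊆ 𝔪_x` by the characteristic-free half of Lemma 3.5.2, and
  `⊄ 𝔪_x²` since its derivative `𝒟^μ(𝓘)_x` is the unit ideal); and as a SECTION:
  `exists_section_germ_not_mem_sq`, `IsOfMaxOrder.exists_tangentDirection_section`;
* `support_inter_subset_zeroLocus` — **Lemma 3.6.4 (2)** ("`supp(𝓘, μ) ∩ U ⊂ V(u)`") for every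
  section `u ∈ 𝒟^{μ-1}(𝓘)(U)` — PROVED (every characteristic);
* **Lemma 3.6.4 (1)** ("`V(u)` is smooth") at a point is the tree's
  `IsRegularLocalRing.quotient_span_singleton` (`RegularLocalRingsQuotient.lean`, Matsumura
  Thm. 14.2): `𝒪_{X,x}/(u)` is a regular local ring when `𝒪_{X,x}` is regular and
  `u ∈ 𝔪_x ∖ 𝔪_x²`; recorded here as `IsOfMaxOrder.isRegularLocalRing_quotient_tangentDirection`.

The persistence statements (3)–(6) of Lemma 3.6.4 and Lemma 3.6.2 concern controlled transforms
under blow-ups (Lemma 3.5.3) and are not treated here.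

Numbering: "3.6.x", "3.5.2", "§4 Step 1b" follow the held text of arXiv:1206.3090 as indexed in the
project literature store and all sibling files (`MarkedIdeals.lean`, `DerivativeIdealSheaf.lean`,
`CoefficientIdeals.lean`); the arXiv v1 PDF numbers the same items §2.6, Def. 2.6.1,
Lemmas 2.6.2–2.6.4, Def. 2.6.5, Lemma 2.5.2, with Step 1b on p. 12.

## Sources

* [BGMW 2011] §3.6: Def. 3.6.1, Lemmas 3.6.2–3.6.4, Def. 3.6.5, Lemma 3.6.6; §4 Step 1b
  (arXiv p. 12); Lemma 3.5.2 (held-text numbering, see above). [BierstoneGrigorievMilmanWlodarczyk2011]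
* H. Matsumura, *Commutative Ring Theory* (1986), Thm. 14.2. [Matsumura1987]
-/

noncomputable section

open CategoryTheory AlgebraicGeometry TopologicalSpace IsLocalRing

namespace Literature.AlgebraicGeometry.Resolution

universe u v

section Iter

variable {k : Type v} [CommRing k] {X : Scheme.{u}} (φ : k →+* Γ(X, ⊤))

/-- `𝒟^{i+j}(𝓘) = 𝒟ⁱ(𝒟ʲ(𝓘))`. [folklore] -/
theorem derivIdealSheafIter_add (i j : ℕ) (I : X.IdealSheafData) :
    derivIdealSheafIter φ (i + j) I = derivIdealSheafIter φ i (derivIdealSheafIter φ j I) :=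
  Function.iterate_add_apply _ _ _ _

end Iter

/-! ## Sections with prescribed germs outside `𝔪_x²` -/

section Germs

variable {X : Scheme.{u}}

/-- If the stalk `J_x` of an ideal sheaf is not contained in `𝔪_x²`, then on every affine open
neighbourhood `U` of `x` some SECTION `s ∈ J(U)` has germ outside `𝔪_x²` (the germs of `J(U)`
generate `J_x`). [folklore] -/
theorem exists_section_germ_not_mem_sq (J : X.IdealSheafData) {x : X}
    (hJ : ¬stalkIdeal J x ≤ maximalIdeal (X.presheaf.stalk x) ^ 2) (U : X.affineOpens)
    (hxU : x ∈ (U : X.Opens)) :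
    ∃ s ∈ J.ideal U, (X.presheaf.germ U x hxU).hom s ∉ maximalIdeal (X.presheaf.stalk x) ^ 2 := by
  by_contra h
  push Not at h
  apply hJ
  rw [stalkIdeal_eq_map_germ J U hxU, Ideal.map_le_iff_le_comap]
  exact fun s hs => h s hs

end Germs

namespace MarkedIdeal

variable {k : Type v} [CommRing k] {X : Scheme.{u}} (φ : k →+* Γ(X, ⊤))

/-! ## Marked ideals of maximal order (BGMW Def. 3.6.1) -/

/-- **`(X, 𝓘, E, μ)` is of maximal order** (BGMW Def. 3.6.1, Villamayor's "simple basic object":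
"`max {ord_x(𝓘) | x ∈ X} ≤ μ` or equivalently `𝒟^μ(𝓘) = 𝒪_X`"), in the form `𝒟^μ(𝓘) = 𝒪_X`.
[cite: BierstoneGrigorievMilmanWlodarczyk2011, Def. 3.6.1] -/
def IsOfMaxOrder (M : MarkedIdeal X) : Prop :=
  derivIdealSheafIter φ M.mult M.ideal = ⊤

/-- Unfolding `IsOfMaxOrder`. [cite: BierstoneGrigorievMilmanWlodarczyk2011, Def. 3.6.1] -/
theorem isOfMaxOrder_iff (M : MarkedIdeal X) :
    M.IsOfMaxOrder φ ↔ derivIdealSheafIter φ M.mult M.ideal = ⊤ :=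
  Iff.rfl

/-- A marked ideal of multiplicity `0` is of maximal order iff `𝓘 = 𝒪_X`. [folklore] -/
theorem isOfMaxOrder_iff_of_mult_eq_zero (M : MarkedIdeal X) (h : M.mult = 0) :
    M.IsOfMaxOrder φ ↔ M.ideal = ⊤ := by
  rw [isOfMaxOrder_iff, h, derivIdealSheafIter_zero]

variable {φ}

namespace IsOfMaxOrder

/-- **BGMW Lemma 3.6.3** (Villamayor): if `(𝓘, μ)` is of maximal order and `i ≤ μ`, then
`𝒟ⁱ(𝓘, μ) = (𝒟ⁱ(𝓘), μ - i)` is of maximal order: `𝒟^{μ-i}(𝒟ⁱ(𝓘)) = 𝒟^μ(𝓘) = 𝒪_X`.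
[cite: BierstoneGrigorievMilmanWlodarczyk2011, Lemma 3.6.3] -/
theorem deriv {M : MarkedIdeal X} (h : M.IsOfMaxOrder φ) {i : ℕ} (hi : i ≤ M.mult) :
    (M.deriv φ i).IsOfMaxOrder φ := by
  rw [isOfMaxOrder_iff, deriv_ideal, deriv_mult, ← derivIdealSheafIter_add, Nat.sub_add_cancel hi]
  exact h

/-- The stalks of `𝒟^μ(𝓘)` are the unit ideal. [folklore] -/
theorem stalkIdeal_eq_top {M : MarkedIdeal X} (h : M.IsOfMaxOrder φ) (x : X) :
    stalkIdeal (derivIdealSheafIter φ M.mult M.ideal) x = ⊤ := by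
  rw [show derivIdealSheafIter φ M.mult M.ideal = ⊤ from h, stalkIdeal_top]

/-- **Maximal order bounds the order** (the implication "`𝒟^μ(𝓘) = 𝒪_X ⇒ ord_x 𝓘 ≤ μ` for all
`x`" in BGMW Def. 3.6.1, valid in every characteristic): `𝓘_x ⊆ 𝔪_x^{μ+1}` would force
`𝒟^μ(𝓘)_x ⊆ 𝔪_x` (Leibniz, Lemma 3.5.2 `⊆`). [cite: BierstoneGrigorievMilmanWlodarczyk2011, Def. 3.6.1] -/
theorem idealOrder_le (hX : HasFinitePresentationDifferentials φ) {M : MarkedIdeal X}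
    (h : M.IsOfMaxOrder φ) (x : X) : idealOrder M.ideal x ≤ M.mult := by
  by_contra hlt
  rw [not_le] at hlt
  have hle : ((M.mult + 1 : ℕ) : ℕ∞) ≤ idealOrder M.ideal x := by
    rw [Nat.cast_add, Nat.cast_one]
    exact Order.add_one_le_of_lt hlt
  have h1 := stalkIdeal_derivIdealSheafIter_le_pow hX ((le_idealOrder_iff _ _ _).mp hle) M.mult
  rw [h.stalkIdeal_eq_top x, Nat.add_sub_cancel_left, pow_one, top_le_iff] at h1
  exact (maximalIdeal.isMaximal (X.presheaf.stalk x)).ne_top h1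

/-- **Tangent directions exist at the points of the support** (BGMW Def. 3.6.5; Step 1b,
arXiv p. 12: "for any `x ∈ supp 𝓙` find a tangent direction `u ∈ 𝒟^{μ(𝓙)-1}(𝓙)` on some neighborhood
of `x`"): if `(𝓘, μ)` is of maximal order, `μ ≥ 1` and `x ∈ supp(𝓘, μ)`, then some
`u ∈ 𝒟^{μ-1}(𝓘)_x` has order exactly one: `u ∈ 𝔪_x`, `u ∉ 𝔪_x²`. Valid in EVERY characteristic:
`𝒟^{μ-1}(𝓘)_x ⊆ 𝔪_x` by the characteristic-free inclusion of Lemma 3.5.2, and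
`𝒟^{μ-1}(𝓘)_x ⊄ 𝔪_x²` because its derivative ideal `𝒟^μ(𝓘)_x` is the unit ideal.
[cite: BierstoneGrigorievMilmanWlodarczyk2011, Def. 3.6.5] -/
theorem exists_tangentDirection (hX : HasFinitePresentationDifferentials φ) {M : MarkedIdeal X}
    (h : M.IsOfMaxOrder φ) (hμ : 1 ≤ M.mult) {x : X} (hx : x ∈ M.support) :
    ∃ u ∈ stalkIdeal (derivIdealSheafIter φ (M.mult - 1) M.ideal) x,
      u ∈ maximalIdeal (X.presheaf.stalk x) ∧ u ∉ maximalIdeal (X.presheaf.stalk x) ^ 2 := by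
  have hsub : stalkIdeal (derivIdealSheafIter φ (M.mult - 1) M.ideal) x ≤
      maximalIdeal (X.presheaf.stalk x) := by
    have := stalkIdeal_derivIdealSheafIter_le_pow hX ((M.mem_support_iff x).mp hx) (M.mult - 1)
    rwa [Nat.sub_sub_self hμ, pow_one] at this
  have hnot : ¬stalkIdeal (derivIdealSheafIter φ (M.mult - 1) M.ideal) x ≤
      maximalIdeal (X.presheaf.stalk x) ^ 2 := by
    intro h2
    have h3 := stalkIdeal_derivIdealSheaf_le_pow hX h2
    rw [← derivIdealSheafIter_succ, Nat.sub_add_cancel hμ, h.stalkIdeal_eq_top x,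
      show (2 - 1 : ℕ) = 1 from rfl, pow_one, top_le_iff] at h3
    exact (maximalIdeal.isMaximal (X.presheaf.stalk x)).ne_top h3
  obtain ⟨u, hu, hu2⟩ := Set.not_subset.mp hnot
  exact ⟨u, hu, hsub hu, hu2⟩

/-- **A tangent direction as a section** (BGMW Def. 3.6.5: "`u ∈ T(𝓘)(U) := 𝒟^{μ-1}(𝓘(U))` of
multiplicity one"): under the hypotheses of `exists_tangentDirection`, on every affine open
neighbourhood `U` of `x` there is a section `u ∈ 𝒟^{μ-1}(𝓘)(U)` whose germ at `x` lies in
`𝔪_x ∖ 𝔪_x²`. [cite: BierstoneGrigorievMilmanWlodarczyk2011, Def. 3.6.5] -/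
theorem exists_tangentDirection_section (hX : HasFinitePresentationDifferentials φ)
    {M : MarkedIdeal X} (h : M.IsOfMaxOrder φ) (hμ : 1 ≤ M.mult) {x : X} (hx : x ∈ M.support)
    (U : X.affineOpens) (hxU : x ∈ (U : X.Opens)) :
    ∃ u ∈ (derivIdealSheafIter φ (M.mult - 1) M.ideal).ideal U,
      (X.presheaf.germ U x hxU).hom u ∈ maximalIdeal (X.presheaf.stalk x) ∧
        (X.presheaf.germ U x hxU).hom u ∉ maximalIdeal (X.presheaf.stalk x) ^ 2 := by
  set J := derivIdealSheafIter φ (M.mult - 1) M.ideal with hJ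
  have hsub : stalkIdeal J x ≤ maximalIdeal (X.presheaf.stalk x) := by
    obtain ⟨u, hu, -, -⟩ := h.exists_tangentDirection hX hμ hx
    have := stalkIdeal_derivIdealSheafIter_le_pow hX ((M.mem_support_iff x).mp hx) (M.mult - 1)
    rwa [Nat.sub_sub_self hμ, pow_one] at this
  have hnot : ¬stalkIdeal J x ≤ maximalIdeal (X.presheaf.stalk x) ^ 2 := by
    intro h2
    obtain ⟨u, hu, -, hu2⟩ := h.exists_tangentDirection hX hμ hx
    exact hu2 (h2 hu)
  obtain ⟨s, hs, hs2⟩ := exists_section_germ_not_mem_sq J hnot U hxU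
  refine ⟨s, hs, hsub ?_, hs2⟩
  rw [stalkIdeal_eq_map_germ J U hxU]
  exact Ideal.mem_map_of_mem _ hs

/-- **BGMW Lemma 3.6.4 (1) at a point** ("`V(u)` is smooth", for `u` a tangent direction): at a
point `x ∈ supp(𝓘, μ)` with regular local ring `𝒪_{X,x}`, the tangent direction `u` of
`exists_tangentDirection` cuts out a regular local ring `𝒪_{X,x}/(u)` (Matsumura Thm. 14.2,
`IsRegularLocalRing.quotient_span_singleton`). [cite: BierstoneGrigorievMilmanWlodarczyk2011, Lemma 3.6.4 (1)] -/
theorem isRegularLocalRing_quotient_tangentDirection (hX : HasFinitePresentationDifferentials φ)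
    {M : MarkedIdeal X} (h : M.IsOfMaxOrder φ) (hμ : 1 ≤ M.mult) {x : X} (hx : x ∈ M.support)
    [IsRegularLocalRing (X.presheaf.stalk x)] :
    ∃ u ∈ stalkIdeal (derivIdealSheafIter φ (M.mult - 1) M.ideal) x,
      IsRegularLocalRing (X.presheaf.stalk x ⧸ Ideal.span {u}) := by
  obtain ⟨u, hu, hum, hu2⟩ := h.exists_tangentDirection hX hμ hx
  exact ⟨u, hu, (IsRegularLocalRing.quotient_span_singleton hum hu2).1⟩

end IsOfMaxOrder

/-! ## BGMW Lemma 3.6.4 (2): the support lies on the hypersurface `V(u)` -/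

/-- **BGMW Lemma 3.6.4 (2)** ("`supp(𝓘, μ) ∩ U ⊂ V(u)`"): for `μ ≥ 1` and ANY section
`u ∈ 𝒟^{μ-1}(𝓘)(U)` over an affine open `U`, the support of `(𝓘, μ)` meets `U` inside the zero
locus of `u` (`supp(𝓘, μ) ⊆ supp(𝒟^{μ-1}(𝓘), 1) = V(𝒟^{μ-1}(𝓘)) ⊆ V(u)`; every characteristic,
no maximal-order hypothesis). [cite: BierstoneGrigorievMilmanWlodarczyk2011, Lemma 3.6.4 (2)] -/
theorem support_inter_subset_zeroLocus (hX : HasFinitePresentationDifferentials φ)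
    (M : MarkedIdeal X) (hμ : 1 ≤ M.mult) (U : X.affineOpens) {u : Γ(X, U)}
    (hu : u ∈ (derivIdealSheafIter φ (M.mult - 1) M.ideal).ideal U) :
    M.support ∩ (U : Set X) ⊆ X.zeroLocus (U := U) {u} := by
  rintro x ⟨hx, hxU⟩
  have h1 : x ∈ (M.deriv φ (M.mult - 1)).support := M.support_subset_support_deriv hX _ hx
  rw [(M.deriv φ (M.mult - 1)).support_of_mult_eq_one (by simp; omega), deriv_ideal] at h1
  have h2 := (Scheme.IdealSheafData.mem_support_iff_of_mem (I := derivIdealSheafIter φ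
    (M.mult - 1) M.ideal) (U := U) hxU).mp h1
  exact X.zeroLocus_mono (Set.singleton_subset_iff.mpr hu) h2

end MarkedIdeal

end Literature.AlgebraicGeometry.Resolution

end
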